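import Summits.AtomisticToContinuum.FouriersLaw.Theorems.BondHeatUncertaintyExtensiveSnapshotIrreversibilityEnergyWindowDensityFloor
import Literature.MathematicalPhysics.KineticTheory.LangevinSemigroupProofs

/-!
(SPLIT FOR THE 400-LINE CAP by the landing lane, hand-2 g30: this file = part 1 of 3; sequels `…BondHeatUncertaintyExtensiveSnapshotIrreversibilityEnergyWindowHarrisResponseB`, `…BondHeatUncertaintyExtensiveSnapshotIrreversibilityEnergyWindowHarrisResponse` import it in a chain; same namespace, all FQNs unchanged.)
# Crux `ExtensiveSnapshotIrreversibility` (stmt-AtomisticToContinuum-9121): atom A3i through Harris' theorem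

Cell decomp-a2c, lens «grading / quantitative ladder», generation 74 (critic row 1012 (iv): "g74
RUNG NAMED = ROUTE A «HarrisResponse»: A3i_TV ⟸ S1 ∧ S3 with the seam proved over the TREE
Kernel/Harris API (S1 = uniform-in-δ minorisation + Lyapunov constants from tree levers; S3 = the
kernel temperature-Lipschitz estimate `‖P_t^{δ} − P_t^{0}‖_{V→V} ≤ C t |δ|` — the analytic heart,
typed as its OWN def with the V-weight and the t-dependence explicit)").

HEADLINE.  The representative-free form A3i_TV `NessWeightedTVResponse` of atom A3i (`δ ↦
μ_{N,T+δ/2,T−δ/2}` is Lipschitz at `δ = 0` in the `e^{θH}`-weighted total-variation norm, every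
`θ < 1/T`; `…EnergyWindowDensityFloor.lean` §7) is REDUCED to ONE finite-time statement about the
transition kernels of the pinned chain, with everything ergodic DISCHARGED from the tree:

  A3i_TV ⟸ S1 `EquilibriumSkeletonHarris` [PROVED here, from the tree's Harris package]
         ∧ S3 `KernelTemperatureLipschitz` [OPEN · ATTACKABLE-L — the new leaf]
         ∧ A1⁺ `NessExpMomentBoundFull` [PROVED, `…EnergyWindowDensityFloor.lean`],

the seam `nessWeightedTVResponse_of_skeletonHarris_of_kernelLipschitz` being PROVED below by the
standard perturbation argument for `V`-uniformly ergodic Markov kernels (a one-line telescoping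
once the ingredients are in place — see §5), over Mathlib's `Kernel`/`Measure.bind` API and the
tree's `Literature.Probability.Process.Harris` lemmas.

* **S1 `EquilibriumSkeletonHarris`** — at EQUAL bath temperatures `(T, T)` the skeleton chain
  `P_m = P_{T,T;m}` (`m ∈ ℕ` large) converges geometrically to the Gibbs measure `μ_T` in the
  `e^{θH}`-weighted norm: `|P_{nm} g(x) − μ_T(g)| ≤ ᾱⁿ B e^{θH(x)}` for all measurable
  `|g| ≤ e^{θH}`, every `0 < θ < 1/T`.  PROVED (`equilibriumSkeletonHarris_holds`) from
  `pinnedChainSemigroup_harris` (Hairer–Mattingly's Harris theorem on the skeleton, tree) fed by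
  `CuneoEckmannHairerReyBellet2018_H2_holds` (the Lyapunov condition, tree) and
  `pinnedChain_minorization` (CEHR Prop. 3.6, tree), the identification "Gibbs = the
  Krylov–Bogoliubov invariant measure" using weak-NESS uniqueness (the standing hypothesis `hU` of
  every atom) exactly as in `…EnergyWindowExpMoment.lean`.
* **S3 `KernelTemperatureLipschitz`** — THE NEW LEAF: for `0 < θ < θ' < 1/T` there are `δ₀, C`
  with `|P_{T+δ/2,T−δ/2;1} h(z) − P_{T,T;1} h(z)| ≤ C|δ| e^{θ'H(z)}` for `|δ| < δ₀`, all `z` and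
  all measurable `|h| ≤ e^{θH}`: the time-ONE transition kernel is Lipschitz in the bath
  temperatures, from the `e^{θH}`-weighted supremum norm to the `e^{θ'H}`-weighted one.  This is
  a FINITE-TIME SENSITIVITY ("Vega") estimate for a hypoelliptic SDE with polynomial coefficients
  — no steady state, no `N → ∞`, no ergodic theory in it.  Why it should hold: `∂_ε P^{ε}_1 h(z)
  = E[h(z^ε_1) Θ^ε_1(z)]` with a Malliavin weight `Θ^ε_1` built from the pathwise temperature
  derivative `∂_ε z^ε_1` (a linear SDE; `√(2γ(T ± ε/2))` is smooth in `ε` at `0` since `T > 0`)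
  and the inverse Malliavin matrix of `z^ε_1` (Hörmander's condition, CEHR Prop. 4.1 = tree
  `isBracketGenerating_hormanderFamily`); `E|h Θ| ≤ (P^ε_1 e^{pθH})^{1/p} ‖Θ‖_q ≤ e^{c} e^{θH(z)}
  ‖Θ^ε_1(z)‖_q` by (3.4), and `‖Θ^ε_1(z)‖_q` is polynomial in `1 + H(z)` (Norris' lemma with
  polynomial vector fields; the interaction `U'' ≥ 1` keeps the brackets uniformly
  non-degenerate), which the slack `e^{(θ'−θ)H(z)}` absorbs.  Equivalently: since both terms are
  `≤ e^{c}e^{θH(z)}` by (3.4), S3 only has content on the energy shell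
  `H(z) ≲ log(1/|δ|)/(θ'−θ)`, where polynomial weights cost `O(log^k(1/|δ|))` — any bound
  `C|δ|^{1−o(1)}` at fixed weight would already follow; the typed `C|δ|` with slack is the clean
  form.  The weight slack `θ < θ'` is ESSENTIAL to the typing (without it the Jacobian of the
  anharmonic flow, `‖J_1‖ ~ e^{C·H^{1/2}}`, is not paid for) and costs nothing downstream.
* `KernelTemperatureLipschitzSkeleton` (S3m: the same at every integer time `m`) — PROVED from S3
  (`kernelTemperatureLipschitzSkeleton_of_kernelTemperatureLipschitz`) by the telescoping
  `P^δ_{j+1} − P_{j+1} = P^δ_1 (P^δ_j − P_j) + (P^δ_1 − P_1) P_j` and CEHR (3.4)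
  (`lintegral_exp_mul_hamiltonian_pinnedChainSemigroup_le`, tree; the (3.4) growth constant
  `e^{θγ(T_L+T_R)t}` is UNIFORM in `δ` because `(T+δ/2)+(T−δ/2) = 2T`).

Proved here (no `sorry`, standard axioms):

* `equilibriumSkeletonHarris_holds` — **S1 PROVED**;
* `kernelTemperatureLipschitzSkeleton_of_kernelTemperatureLipschitz` — **S3 ⟹ S3m**;
* ★ `nessWeightedTVResponse_of_skeletonHarris_of_kernelLipschitz` — **the seam
  `S1 → S3m → A1⁺ → A3i_TV`**: with `Q = P^δ_m` (`μ_δ Q = μ_δ`: the weak steady state is the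
  Krylov–Bogoliubov invariant measure by `hU`), `ψ_k = P_{km} g − μ_T(g)` (`|ψ_k| ≤ ᾱ^k B e^{θH}`
  by S1, `ψ_{k+1} = P_m ψ_k`) and `a_k = μ_δ(ψ_k)`:  `a_0 = μ_δ(g) − μ_T(g)`,
  `a_k − a_{k+1} = μ_δ((Q − P_m)ψ_k)`, `|a_k − a_{k+1}| ≤ C₃|δ| ᾱ^k B μ_δ(e^{θ'H}) ≤ C₃ C₁ B ᾱ^k |δ|`
  (S3m, A1⁺), `a_n → 0`; hence `|μ_δ(g) − μ_T(g)| ≤ C₃ C₁ B |δ| / (1 − ᾱ)`;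
* `nessWeightedTVResponse_of_kernelTemperatureLipschitz` : **S3 ⟹ A3i_TV**,
  `nessWeightedL1Response_of_kernelTemperatureLipschitz` : **S3 ⟹ A3i**;
* `energyWindowControl_of_atoms₅K` / `snapshotKLUpperExpansion_of_atoms₅K` — **the junction
  `K_fix ⟸ A0 ∧ A2 ∧ S3 ∧ A3p ∧ A4`** (A3i replaced by the kernel leaf S3).

Ladder bookkeeping (9121, fixed-`N` half `K_fix`): `K_fix ⟸ (W) ⟸ A0 ∧ A2 ∧ A3i ∧ A3p ∧ A4`
(`…DensityFloor.lean`), and now `A3i ⟸ S3` with S1, A1⁺ proved: open leaves A2 (IDEA-NEEDED),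
S3 (ATTACKABLE-L: Malliavin "Greeks" sensitivity for a Hörmander SDE with a Lyapunov function;
no Malliavin calculus in Mathlib — long), A3p (ATTACKABLE-L), A4 (OPEN).  S3 is NOT implied by
the record hypothesis `(R)` (it is a statement about kernels, not about the steady state) and
does not mention steady states, `N → ∞` or the conductivity: it is incomparable with
`FouriersLaw` and strictly on the analysis side.  Test functions are MEASURABLE throughout (the
tree's Harris package is typed that way; the continuous / `C_c` phrasings are equivalent by
density in weighted `L¹` of the kernels, which have densities).

References: M. Hairer, J. C. Mattingly, Yet another look at Harris' ergodic theorem for Markov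
chains, Progr. Probab. 63 (2011) 109–117 (arXiv:0810.2777), Thm 1.2/1.3; N. Cuneo,
J.-P. Eckmann, M. Hairer, L. Rey-Bellet, EJP 23 (2018) no. 55 (arXiv:1712.09413), Thm 2.13,
Prop. 3.6, 3.8, eq. (3.4); M. Hairer, A. J. Majda, Nonlinearity 23 (2010) 909–922
(arXiv:0909.4313), Thm 2.3 (linear response from a spectral gap in weighted norms + a
perturbation bound of exactly the type S3); E. Fournié, J.-M. Lasry, J. Lebuchoux, P.-L. Lions,
N. Touzi, Finance Stoch. 3 (1999) 391–412, Prop. 3.1–3.3 (sensitivities w.r.t. drift / initial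
condition / volatility as `E[payoff × Malliavin weight]`); J.-P. Eckmann, C.-A. Pillet,
L. Rey-Bellet, CMP 201 (1999) 657–697, §3 (Malliavin calculus and control at infinity for this
class of chains); J.-P. Eckmann, M. Hairer, CMP 212 (2000) 105–164, §3–4; M. Hairer,
J. C. Mattingly, A theory of hypoellipticity and unique ergodicity for semilinear stochastic
PDEs, EJP 16 (2011) 658–738, §4–6 (Malliavin matrix bounds with Lyapunov structure);
S. P. Meyn, R. L. Tweedie, Markov Chains and Stochastic Stability (1993), Thm 16.0.1/16.1.2;
T. Komorowski, J. L. Lebowitz, S. Olla, Heat flow in a periodically forced, thermostatted chain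
II, arXiv:2209.12923 (linear response of oscillator-chain NESS, for comparison).
-/

noncomputable section

namespace Summit.AtomisticToContinuum.FouriersLaw.Theorems.ExtensiveSnapshotIrreversibility.EnergyWindow

open MeasureTheory ProbabilityTheory Filter Topology Real
open scoped ENNReal NNReal
open Literature.MathematicalPhysics.KineticTheory.HeatConduction
open Literature.Probability.Process

variable {N : ℕ}

/-! ## 1. The statements: the kernel leaf S3, its skeleton form S3m, the equilibrium Harris bound S1 -/

/-- **S3 `KernelTemperatureLipschitz` (the kernel leaf — OPEN · ATTACKABLE-L)**: for the pinned
chain with positive parameters, `T > 0`, `N ≥ 2` and rates `0 < θ < θ' < 1/T` there are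
`δ₀ > 0`, `C` such that for `|δ| < δ₀`, every `z` and every measurable `h` with `|h| ≤ e^{θH}`:
`|P_{T+δ/2,T−δ/2;1} h(z) − P_{T,T;1} h(z)| ≤ C |δ| e^{θ'H(z)}` — the time-one transition kernel
is Lipschitz in the bath temperatures at `(T,T)`, from the `e^{θH}`-weighted sup norm to the
`e^{θ'H}`-weighted one (a Malliavin-weight / "Vega" sensitivity bound for a Hörmander SDE with
polynomial coefficients and the Lyapunov function `e^{θH}`).  The weight slack `θ < θ'` is part of
the statement.  (after FournieLasryLebuchouxLionsTouzi1999, Prop 3.3)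
(after HairerMajda2010, Thm 2.3) (after EckmannPilletReyBellet1999a, §3) [route leaf · named hypothesis of this cell, NOT filed as a literature fact] -/
def KernelTemperatureLipschitz : Prop :=
  ∀ ω₂ lam β γ : ℝ, 0 < ω₂ → 0 < lam → 0 < β → 0 < γ →
    ∀ T : ℝ, 0 < T → ∀ N : ℕ, 2 ≤ N → ∀ θ θ' : ℝ, 0 < θ → θ < θ' → θ' < 1 / T →
      ∃ δ₀ C : ℝ, 0 < δ₀ ∧ ∀ δ : ℝ, |δ| < δ₀ →
        ∀ (z : PhaseSpace N) (h : PhaseSpace N → ℝ), Measurable h →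
          (∀ y, |h y| ≤ Real.exp (θ * (pinnedChain ω₂ lam β γ).hamiltonian N y)) →
          |∫ y, h y ∂((pinnedChain ω₂ lam β γ).transitionKernel N (T + δ / 2) (T - δ / 2) 1 z) -
              ∫ y, h y ∂((pinnedChain ω₂ lam β γ).transitionKernel N T T 1 z)| ≤
            C * |δ| * Real.exp (θ' * (pinnedChain ω₂ lam β γ).hamiltonian N z)

/-- **S3m `KernelTemperatureLipschitzSkeleton`**: S3 at every integer time `m`:
`|P_{T+δ/2,T−δ/2;m} h(z) − P_{T,T;m} h(z)| ≤ C |δ| e^{θ'H(z)}` for `|δ| < δ₀`, all `z`, all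
measurable `|h| ≤ e^{θH}` (`δ₀, C` depending on `m`).  PROVED from S3 below by telescoping and
CEHR (3.4). (after CuneoEckmannHairerReyBellet2018, §3 eq. (3.4)) [route leaf · named hypothesis of this cell, NOT filed as a literature fact] -/
def KernelTemperatureLipschitzSkeleton : Prop :=
  ∀ ω₂ lam β γ : ℝ, 0 < ω₂ → 0 < lam → 0 < β → 0 < γ →
    ∀ T : ℝ, 0 < T → ∀ N : ℕ, 2 ≤ N → ∀ θ θ' : ℝ, 0 < θ → θ < θ' → θ' < 1 / T → ∀ m : ℕ,
      ∃ δ₀ C : ℝ, 0 < δ₀ ∧ ∀ δ : ℝ, |δ| < δ₀ →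
        ∀ (z : PhaseSpace N) (h : PhaseSpace N → ℝ), Measurable h →
          (∀ y, |h y| ≤ Real.exp (θ * (pinnedChain ω₂ lam β γ).hamiltonian N y)) →
          |∫ y, h y ∂((pinnedChain ω₂ lam β γ).transitionKernel N (T + δ / 2) (T - δ / 2) m z) -
              ∫ y, h y ∂((pinnedChain ω₂ lam β γ).transitionKernel N T T m z)| ≤
            C * |δ| * Real.exp (θ' * (pinnedChain ω₂ lam β γ).hamiltonian N z)

/-- **S1 `EquilibriumSkeletonHarris` (PROVED below)**: at equal bath temperatures `(T,T)`, under
weak-NESS uniqueness, for `N ≥ 2` and `0 < θ < 1/T` there are an integer time `m ≥ 1` and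
constants `0 ≤ ᾱ < 1`, `B ≥ 0` with `|P_{T,T;nm} g(x) − ∫ g dμ_T| ≤ ᾱⁿ B e^{θH(x)}` for all
`n`, `x` and all measurable `|g| ≤ e^{θH}` (`μ_T` the Gibbs measure): geometric ergodicity of the
skeleton chain in the `e^{θH}`-weighted norm, with the Gibbs measure as its limit.
(after CuneoEckmannHairerReyBellet2018, Prop 3.8 (proof)) (after HairerMattingly2011, Thm 1.2) [route leaf · named hypothesis of this cell, NOT filed as a literature fact] -/
def EquilibriumSkeletonHarris : Prop :=
  ∀ ω₂ lam β γ : ℝ, 0 < ω₂ → 0 < lam → 0 < β → 0 < γ →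
    (∀ (N : ℕ) (T_L T_R : ℝ), 0 < T_L → 0 < T_R → ∀ μ ν : Measure (PhaseSpace N),
      (pinnedChain ω₂ lam β γ).IsSteadyState N T_L T_R μ →
      (pinnedChain ω₂ lam β γ).IsSteadyState N T_L T_R ν → μ = ν) →
    ∀ T : ℝ, 0 < T → ∀ N : ℕ, 2 ≤ N → ∀ θ : ℝ, 0 < θ → θ < 1 / T →
      ∃ (m : ℕ) (abar B : ℝ), 1 ≤ m ∧ 0 ≤ abar ∧ abar < 1 ∧ 0 ≤ B ∧
        ∀ (n : ℕ) (g : PhaseSpace N → ℝ), Measurable g →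
          (∀ y, |g y| ≤ Real.exp (θ * (pinnedChain ω₂ lam β γ).hamiltonian N y)) →
          ∀ x, |∫ y, g y ∂((pinnedChain ω₂ lam β γ).transitionKernel N T T ((n * m : ℕ) : ℝ≥0) x) -
              ∫ y, g y ∂((pinnedChain ω₂ lam β γ).gibbsMeasure N T)| ≤
            abar ^ n * B * Real.exp (θ * (pinnedChain ω₂ lam β γ).hamiltonian N x)

/-! ## 2. Toolbox: `e^{ϑH}`-weighted integrals -/

/-- **Affine-bound toolbox**: if `∫⁻ e^{ϑH} dν ≤ R` (`ν` finite) and `|φ| ≤ L e^{ϑH}` with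
`L ≥ 0`, `φ` measurable, then `φ ∈ L¹(ν)` and `|∫ φ dν| ≤ L R`. [folklore] -/
theorem integrable_and_abs_integral_le_of_abs_le_exp (P : OscillatorChain)
    (hH : Measurable (P.hamiltonian N)) {ν : Measure (PhaseSpace N)} [IsFiniteMeasure ν]
    {ϑ L R : ℝ} (hR : 0 ≤ R) (hL : 0 ≤ L)
    (hν : ∫⁻ y, ENNReal.ofReal (Real.exp (ϑ * P.hamiltonian N y)) ∂ν ≤ ENNReal.ofReal R)
    {φ : PhaseSpace N → ℝ} (hφm : Measurable φ)
    (hφ : ∀ y, |φ y| ≤ L * Real.exp (ϑ * P.hamiltonian N y)) :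
    Integrable φ ν ∧ |∫ y, φ y ∂ν| ≤ L * R := by
  set V : PhaseSpace N → ℝ≥0 := fun y => (Real.exp (ϑ * P.hamiltonian N y)).toNNReal with hVdef
  have hV : Measurable V := (measurable_real_toNNReal.comp ((hH.const_mul ϑ).exp))
  have hVcoe : ∀ y, (V y : ℝ≥0∞) = ENNReal.ofReal (Real.exp (ϑ * P.hamiltonian N y)) :=
    fun y => rfl
  have hVreal : ∀ y, (V y : ℝ) = Real.exp (ϑ * P.hamiltonian N y) := fun y =>
    Real.coe_toNNReal _ (Real.exp_pos _).le
  have hν' : ∫⁻ y, (V y : ℝ≥0∞) ∂ν ≤ ENNReal.ofReal R := by simpa only [hVcoe] using hν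
  have hVν : ∫⁻ y, (V y : ℝ≥0∞) ∂ν ≠ ∞ := ne_top_of_le_ne_top ENNReal.ofReal_ne_top hν'
  have hφ' : ∀ y, |φ y| ≤ 0 + L * V y := fun y => by rw [zero_add, hVreal]; exact hφ y
  refine ⟨Harris.integrable_of_abs_le_affine hV hVν hφm hφ', ?_⟩
  calc |∫ y, φ y ∂ν| ≤ 0 * ν.real Set.univ + L * (∫⁻ y, (V y : ℝ≥0∞) ∂ν).toReal :=
        Harris.abs_integral_le_of_abs_le_affine hV hVν hφm hφ'
    _ ≤ L * R := by
        rw [zero_mul, zero_add]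
        exact mul_le_mul_of_nonneg_left (ENNReal.toReal_le_of_le_ofReal hR hν') hL

section Pinned

variable {ω₂ lam β γ : ℝ} (hω : 0 < ω₂) (hl : 0 < lam) (hβ : 0 < β) (hγ : 0 < γ)
include hω hl hβ hγ

/-- **CEHR (3.4) as a toolbox**: for bath temperatures `0 < T_L, T_R` and `0 < ϑ < 1/max(T_L,T_R)`,
`N ≥ 1`: if `|φ| ≤ L e^{ϑH}` (`L ≥ 0`, `φ` measurable) then `φ ∈ L¹(P_t(x,·))` and
`|P_t φ(x)| ≤ L e^{ϑγ(T_L+T_R)t} e^{ϑH(x)}`. [cite: CuneoEckmannHairerReyBellet2018, §3 eq. (3.4)] -/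
theorem integrable_and_abs_integral_transitionKernel_le (hN : 0 < N) {T_L T_R : ℝ}
    (hTL : 0 < T_L) (hTR : 0 < T_R) {ϑ : ℝ} (hϑ : 0 < ϑ) (hϑ' : ϑ < 1 / max T_L T_R)
    (t : ℝ≥0) (x : PhaseSpace N) {L : ℝ} (hL : 0 ≤ L) {φ : PhaseSpace N → ℝ}
    (hφm : Measurable φ)
    (hφ : ∀ y, |φ y| ≤ L * Real.exp (ϑ * (pinnedChain ω₂ lam β γ).hamiltonian N y)) :
    Integrable φ ((pinnedChain ω₂ lam β γ).transitionKernel N T_L T_R t x) ∧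
      |∫ y, φ y ∂((pinnedChain ω₂ lam β γ).transitionKernel N T_L T_R t x)| ≤
        L * (Real.exp (ϑ * γ * (T_L + T_R) * t) *
          Real.exp (ϑ * (pinnedChain ω₂ lam β γ).hamiltonian N x)) := by
  haveI := pinnedChain_isMarkovKernel_transitionKernel hω hl.le hβ.le hγ.le N T_L T_R t
  exact integrable_and_abs_integral_le_of_abs_le_exp (pinnedChain ω₂ lam β γ)
    (pinnedChain_continuous_hamiltonian ω₂ lam β γ N).measurable (by positivity) hL
    (lintegral_exp_mul_hamiltonian_pinnedChainSemigroup_le hω hl.le hβ.le hγ.le hN hTL.le hTR.le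
      hTL hTR hϑ hϑ' t x) hφm hφ

/-- **Chapman–Kolmogorov in integral form**: `P_{s+t} f(x) = ∫ P_t f(w) P_s(x, dw)` for
`f ∈ L¹(P_{s+t}(x,·))`. [folklore] -/
theorem integral_transitionKernel_add (T_L T_R : ℝ) (s t : ℝ≥0) (x : PhaseSpace N)
    {f : PhaseSpace N → ℝ}
    (hf : Integrable f ((pinnedChain ω₂ lam β γ).transitionKernel N T_L T_R (s + t) x)) :
    ∫ y, f y ∂((pinnedChain ω₂ lam β γ).transitionKernel N T_L T_R (s + t) x) =
      ∫ w, ∫ y, f y ∂((pinnedChain ω₂ lam β γ).transitionKernel N T_L T_R t w)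
        ∂((pinnedChain ω₂ lam β γ).transitionKernel N T_L T_R s x) := by
  rw [pinnedChain_transitionKernel_add hω hl.le hβ.le hγ.le N T_L T_R s t, Kernel.comp_apply]
    at hf ⊢
  exact Harris.integral_comp_measure _ _ hf

/-- `P_0 f = f`. [folklore] -/
theorem integral_transitionKernel_zero (T_L T_R : ℝ) (x : PhaseSpace N) (f : PhaseSpace N → ℝ) :
    ∫ y, f y ∂((pinnedChain ω₂ lam β γ).transitionKernel N T_L T_R 0 x) = f x := by
  rw [pinnedChain_transitionKernel_zero hω hl.le hβ.le hγ.le N T_L T_R, Kernel.id_apply,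
    integral_dirac]

end Pinned

/-! ## 3. S1 PROVED: Harris on the skeleton at equilibrium, with the Gibbs measure as the limit -/

/-- ★ **S1 PROVED.**  Harris' theorem for the skeleton `P_m` (`pinnedChainSemigroup_harris`, fed
by `CuneoEckmannHairerReyBellet2018_H2_holds` and `pinnedChain_minorization`) gives geometric
convergence to every `P_m`-invariant probability measure with a finite `e^{θH}`-moment; the Gibbs
measure is one: it is a weak steady state at `(T,T)` (`pinnedChain_isSteadyState_gibbsMeasure`),
hence (weak-NESS uniqueness `hU`) equal to the Krylov–Bogoliubov invariant probability measure of
the semigroup (`pinnedChainSemigroup_exists_isInvariant` + `pinnedChain_isSteadyState_of_isInvariant`),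
which is invariant under every `P_t`.  The constant: `B = b⁻¹(2 + b μ_T(e^{θH})) + 1`, as in the
tree's proof of CEHR (2.5). [cite: CuneoEckmannHairerReyBellet2018, Prop 3.8 (proof)] -/
theorem equilibriumSkeletonHarris_holds : EquilibriumSkeletonHarris := by
  intro ω₂ lam β γ hω hl hβ hγ hU T hT N hN θ hθ hθ1
  have hN0 : 0 < N := lt_of_lt_of_le (by norm_num) hN
  have hθ1' : θ < 1 / max T T := by rw [max_self]; exact hθ1
  set S := pinnedChainSemigroup hω hl.le hβ.le hγ.le hN0 hT.le hT.le with hS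
  set Hm := (pinnedChain ω₂ lam β γ).hamiltonian N with hHm
  obtain ⟨m, abar, b, hm, ha0, ha1, hb, -, hmom⟩ :=
    pinnedChainSemigroup_harris hω hl.le hβ hγ hN0 hT hT CuneoEckmannHairerReyBellet2018_H2_holds
      (pinnedChain_minorization hω hl.le hβ hγ hN0 hT hT) hθ hθ1'
  -- the Gibbs measure is THE invariant probability measure of the semigroup
  obtain ⟨μKB, hμKB, hinv, hint⟩ := pinnedChainSemigroup_exists_isInvariant hω hl.le hβ hγ hN0 hT hT
    CuneoEckmannHairerReyBellet2018_H2_holds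
  haveI := hμKB
  have hKBss : (pinnedChain ω₂ lam β γ).IsSteadyState N T T μKB :=
    pinnedChain_isSteadyState_of_isInvariant hω.le hl.le hβ.le γ N _ hinv hθ (hint θ hθ hθ1')
  haveI : IsProbabilityMeasure ((pinnedChain ω₂ lam β γ).gibbsMeasure N T) :=
    pinnedChain_isProbabilityMeasure_gibbsMeasure hω hl.le hβ.le γ N hT
  have hG : (pinnedChain ω₂ lam β γ).gibbsMeasure N T = μKB :=
    hU N T T hT hT _ _ (pinnedChain_isSteadyState_gibbsMeasure hω hl.le hβ.le γ N hT) hKBss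
  have hGinv : Kernel.Invariant (S.kernel m) ((pinnedChain ω₂ lam β γ).gibbsMeasure N T) := by
    rw [hG]; exact hinv m
  obtain ⟨-, hgeo⟩ := hmom _ ‹_› hGinv
  -- constants
  set M : ℝ := (∫⁻ z, ENNReal.ofReal (Real.exp (θ * Hm z))
    ∂((pinnedChain ω₂ lam β γ).gibbsMeasure N T)).toReal with hM
  have hM0 : 0 ≤ M := ENNReal.toReal_nonneg
  have hb0 : b ≠ 0 := hb.ne'
  set B : ℝ := b⁻¹ * (2 + b * M) + 1 with hBdef
  have hB0 : 0 ≤ B := by rw [hBdef]; positivity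
  have hV1 : ∀ z, 1 ≤ Real.exp (θ * Hm z) := fun z =>
    Real.one_le_exp (mul_nonneg hθ.le (pinnedChain_hamiltonian_nonneg hω.le hl.le hβ.le γ N z))
  refine ⟨m, abar, B, Nat.succ_le_of_lt hm, ha0.le, ha1, hB0, fun n g hgm hg x => ?_⟩
  -- the kernel at time `n m` is the `n`-th power of the skeleton kernel
  have hpow : (pinnedChain ω₂ lam β γ).transitionKernel N T T ((n * m : ℕ) : ℝ≥0) =
      S.kernel m ^ n := by
    rw [← S.kernel_nat_mul, ← Nat.cast_mul]; rfl
  rw [hpow]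
  have hφm : Measurable fun y => b * g y := hgm.const_mul b
  have hφ : ∀ y, |b * g y| ≤ 1 + b * Real.exp (θ * Hm y) := fun y => by
    rw [abs_mul, abs_of_pos hb]
    have := mul_le_mul_of_nonneg_left (hg y) hb.le
    linarith
  have h := hgeo n (fun y => b * g y) hφm hφ x
  rw [integral_const_mul, integral_const_mul, ← mul_sub, abs_mul, abs_of_pos hb] at h
  have h' : |∫ y, g y ∂((S.kernel m ^ n) x) -
      ∫ y, g y ∂((pinnedChain ω₂ lam β γ).gibbsMeasure N T)| ≤
      abar ^ n * (b⁻¹ * (2 + b * M) + Real.exp (θ * Hm x)) := by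
    have h1 := mul_le_mul_of_nonneg_left h (inv_nonneg.2 hb.le)
    rw [inv_mul_cancel_left₀ hb0] at h1
    refine h1.trans (le_of_eq ?_)
    field_simp
    ring
  refine h'.trans ?_
  rw [mul_assoc]
  refine mul_le_mul_of_nonneg_left ?_ (pow_nonneg ha0.le n)
  have hE := hV1 x
  have hpos : 0 ≤ b⁻¹ * (2 + b * M) := by positivity
  rw [hBdef]
  nlinarith [mul_nonneg hpos (sub_nonneg.2 hE)]

end Summit.AtomisticToContinuum.FouriersLaw.Theorems.ExtensiveSnapshotIrreversibility.EnergyWindow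

end
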